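import Summits.Ventures.QEC.CircuitDistance.PortFibre
import Summits.Ventures.QEC.Census.CNFEncodeSound
import HarnessLib

/-!
# P3-PORT (D2): fibre LEAVES — the data of a per-word fibre CNF, its decidable well-formedness, and LEAF SOUNDNESS
# (cell `qec`, experiment CDX, seat qec-cdx-type-1)

A fibre leaf (eng-1's `FibreLeaves*.lean` literals) is `cnfEncodeAny n rows us w` over coordinates `0 … n−1` = candidate
DEM columns, grouped as `C₀, …, C_{k−1}` (one group per generator of the word, in the word's order) plus null coordinates;
`coords[c]` = the ENCODED detector rows of coordinate `c`; `rows` = detector rows (coordinates containing a detector)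
followed by the link rows `C₀ ++ C_j`; `us = [C₀]`; `w = k + b`.  Here: the record `Leaf` of that data, the DECIDABLE
well-formedness predicate `Leaf.wf` (every CNF row is a detector row or a link row up to permutation, coordinates `< n`
and pairwise distinct, `us = [C₀]`, `k ≤ w`), the notion of a REALISATION (one coordinate per group + `≤ b` null
coordinates covering every encoded detector an even number of times), and **`Leaf.not_realised_of_unsat`**: a well-formed
leaf whose CNF is unsatisfiable has no realisation — via the tree's encoding-soundness theorem
`Census.CNFEncode.cnfEncodeAny_unsat_imp`.  Generic; nothing here mentions a circuit.
-/

namespace Summit.Ventures.QEC.CircuitDistance.Fibre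

open Finset

variable {ι δ γ V : Type*} [DecidableEq ι] [DecidableEq δ] [DecidableEq γ]
variable [AddCommGroup V] [Module (ZMod 2) V]

/-! ## Fibre leaves -/

/-- The DATA of a fibre leaf: `n` coordinates, `coords[c]` = encoded detector rows of coordinate `c`, coordinate `groups`
(one per generator of the word, in the word's order), `nulls` = null coordinates, and the CNF parameters `rows`, `us`, `w`
(literally those of `cnfEncodeAny n rows us w`). -/
structure Leaf where
  /-- number of coordinates -/
  n : ℕ
  /-- encoded detector rows of each coordinate -/
  coords : List (List ℕ)
  /-- coordinate groups, one per generator of the word -/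
  groups : List (List ℕ)
  /-- null coordinates -/
  nulls : List ℕ
  /-- parity rows of the CNF -/
  rows : List (List ℕ)
  /-- odd-parity targets of the CNF -/
  us : List (List ℕ)
  /-- weight bound of the CNF -/
  w : ℕ

/-- Number of coordinate groups (= weight of the word). -/
def Leaf.k (L : Leaf) : ℕ := L.groups.length

/-- The `j`-th coordinate group (empty if out of range). -/
def Leaf.group (L : Leaf) (j : ℕ) : List ℕ := L.groups.getD j []

/-- The detector rows of coordinate `c` (empty if out of range). -/
def Leaf.coordsOf (L : Leaf) (c : ℕ) : List ℕ := L.coords.getD c []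

/-- All encoded detectors mentioned by the leaf. -/
def Leaf.detectors (L : Leaf) : List ℕ := L.coords.flatten.dedup

/-- The detector row of `d`: the coordinates `< n` whose column contains `d`, increasing. -/
def Leaf.detRow (L : Leaf) (d : ℕ) : List ℕ := (List.range L.n).filter fun c => d ∈ L.coordsOf c

/-- The ADMISSIBLE rows: detector rows, and the group-link rows `C₀ ++ C_j` (`j ≥ 1`, 0-indexed). -/
def Leaf.admissible (L : Leaf) : List (List ℕ) :=
  (L.detectors.map L.detRow) ++ (((List.range L.k).filter fun j => j ≠ 0).map fun j => L.group 0 ++ L.group j)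

/-- DECIDABLE WELL-FORMEDNESS of a leaf: at least one group; group/null coordinates `< n` and pairwise distinct; every CNF
row is admissible up to permutation; `us = [C₀]`; `k ≤ w` (budget `b = w − k`). -/
def Leaf.wf (L : Leaf) : Bool :=
  decide (0 < L.k) &&
  ((L.groups.flatten ++ L.nulls).all fun c => decide (c < L.n)) &&
  decide (L.groups.flatten ++ L.nulls).Nodup &&
  (L.rows.all fun r => L.admissible.any fun a => decide (r.Perm a)) &&
  decide (L.us = [L.group 0]) &&
  decide (L.k ≤ L.w)

/-- The budget `b = w − k`. -/
def Leaf.budget (L : Leaf) : ℕ := L.w - L.k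

/-- A REALISATION of a leaf: one coordinate in each group plus a set of null coordinates within budget such that every
encoded detector is covered an even number of times. -/
def Leaf.Realised (L : Leaf) : Prop :=
  ∃ (pick : Fin L.k → ℕ) (N : Finset ℕ),
    (∀ j : Fin L.k, pick j ∈ L.group (j : ℕ)) ∧ (∀ c ∈ N, c ∈ L.nulls) ∧ N.card ≤ L.budget ∧
    ∀ d, Even ((Finset.univ.filter fun j : Fin L.k => d ∈ L.coordsOf (pick j)).card +
      (N.filter fun c => d ∈ L.coordsOf c).card)

/-! ### Bridging lists and finsets -/

/-- The XOR-parity of `CNFEncode.lparity` is the parity of the count. -/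
theorem lparity_iff_odd (a : ℕ → Bool) (r : List ℕ) :
    Census.CNFEncode.lparity a r = true ↔ Odd (r.countP fun x => a x) := by
  induction r with
  | nil => simp [Census.CNFEncode.lparity]
  | cons x xs ih =>
    rw [Census.CNFEncode.lparity, List.countP_cons]
    cases hx : a x
    · simpa using ih
    · have h1 : Odd (List.countP (fun x => a x) xs + 1) ↔ ¬ Odd (List.countP (fun x => a x) xs) := Nat.odd_add_one
      simp only [ite_true, Bool.true_xor, h1, ← ih]
      cases Census.CNFEncode.lparity a xs <;> simp

/-- Counting members of a finset along a duplicate-free list. -/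
theorem countP_mem_eq_card (l : List ℕ) (hl : l.Nodup) (T : Finset ℕ) :
    l.countP (fun c => decide (c ∈ T)) = (l.toFinset ∩ T).card := by
  rw [List.countP_eq_length_filter, ← List.toFinset_card_of_nodup (hl.filter _), List.toFinset_filter]
  congr 1
  ext c
  simp [Finset.mem_filter, Finset.mem_inter]

/-- An in-range group is one of the groups. -/
theorem group_mem_groups (L : Leaf) {j : ℕ} (hj : j < L.k) : L.group j ∈ L.groups := by
  unfold Leaf.group
  rw [List.getD_eq_getElem _ _ hj]
  exact List.getElem_mem hj

/-- Members of in-range groups are group coordinates. -/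
theorem mem_flatten_of_mem_group (L : Leaf) {j : ℕ} (hj : j < L.k) {c : ℕ} (hc : c ∈ L.group j) :
    c ∈ L.groups.flatten :=
  List.mem_flatten.2 ⟨_, group_mem_groups L hj, hc⟩

/-- **LEAF SOUNDNESS.** A well-formed leaf whose CNF is unsatisfiable has no realisation (the realisation's indicator
assignment would solve `Q_any(rows, us, w)`: detector rows even by the covering condition, link rows even because every
group holds exactly one chosen coordinate, `C₀` odd, weight `k + |N| ≤ w`). -/
theorem Leaf.not_realised_of_unsat (L : Leaf) (hwf : L.wf = true)
    (h : (Census.CNFEncode.cnfEncodeAny L.n L.rows L.us L.w).Unsat) : ¬ L.Realised := by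
  classical
  rintro ⟨pick, N, hpick, hN, hNcard, heven⟩
  simp only [Leaf.wf, Bool.and_eq_true, decide_eq_true_eq, List.all_eq_true, List.any_eq_true] at hwf
  obtain ⟨⟨⟨⟨⟨hk, hlt⟩, hnodup⟩, hrows⟩, hus⟩, hkw⟩ := hwf
  -- structure of the groups
  have hnd := List.nodup_append.1 hnodup
  have hflat_nd : L.groups.flatten.Nodup := hnd.1
  have hdisjN : ∀ c ∈ L.groups.flatten, c ∉ L.nulls := fun c hc hcn => hnd.2.2 c hc c hcn rfl
  have hgroups_nd : ∀ l ∈ L.groups, l.Nodup := (List.nodup_flatten.1 hflat_nd).1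
  have hgroups_pw : L.groups.Pairwise List.Disjoint := (List.nodup_flatten.1 hflat_nd).2
  -- the chosen coordinate set
  set T : Finset ℕ := (Finset.univ.image pick) ∪ N with hT
  let a : ℕ → Bool := fun c => decide (c ∈ T)
  have hpick_lt : ∀ j, pick j < L.n := fun j =>
    hlt _ (List.mem_append_left _ (mem_flatten_of_mem_group L j.2 (hpick j)))
  have hT_lt : ∀ c ∈ T, c < L.n := by
    intro c hc
    rcases Finset.mem_union.1 hc with hc | hc
    · obtain ⟨j, -, rfl⟩ := Finset.mem_image.1 hc; exact hpick_lt j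
    · exact hlt _ (List.mem_append_right _ (hN c hc))
  -- pick is injective and its image misses N
  have hpick_inj : Function.Injective pick := by
    intro j j' hjj'
    by_contra hne
    have hne' : (j : ℕ) ≠ j' := fun e => hne (Fin.ext e)
    have h1 : pick j ∈ L.group j := hpick j
    have h2 : pick j' ∈ L.group j' := hpick j'
    -- groups j and j' are disjoint
    have hdis : List.Disjoint (L.group j) (L.group j') := by
      unfold Leaf.group
      rw [List.getD_eq_getElem _ _ j.2, List.getD_eq_getElem _ _ j'.2]
      rcases Nat.lt_or_gt_of_ne hne' with hlt' | hlt'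
      · exact List.Pairwise.rel_get_of_lt (R := List.Disjoint) hgroups_pw (a := ⟨j, j.2⟩) (b := ⟨j', j'.2⟩) hlt'
      · exact (List.Pairwise.rel_get_of_lt (R := List.Disjoint) hgroups_pw (a := ⟨j', j'.2⟩) (b := ⟨j, j.2⟩) hlt').symm
    exact hdis h1 (hjj' ▸ h2)
  have hdisj : Disjoint (Finset.univ.image pick) N := by
    rw [Finset.disjoint_left]
    intro c hc hcN
    obtain ⟨j, -, rfl⟩ := Finset.mem_image.1 hc
    exact hdisjN _ (mem_flatten_of_mem_group L j.2 (hpick j)) (hN _ hcN)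
  -- counting a group: exactly one chosen coordinate
  have hcount_group : ∀ j : Fin L.k, (L.group j).countP (fun c => a c) = 1 := by
    intro j
    have hgnd : (L.group j).Nodup := hgroups_nd _ (group_mem_groups L j.2)
    show (L.group j).countP (fun c => decide (c ∈ T)) = 1
    rw [countP_mem_eq_card _ hgnd, Finset.card_eq_one]
    refine ⟨pick j, ?_⟩
    ext c
    simp only [Finset.mem_inter, List.mem_toFinset, Finset.mem_singleton]
    constructor
    · rintro ⟨hc, hcT⟩
      rcases Finset.mem_union.1 hcT with hcT | hcT
      · obtain ⟨j', -, rfl⟩ := Finset.mem_image.1 hcT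
        by_cases hjj : j' = j
        · rw [hjj]
        · exfalso
          have hne' : (j' : ℕ) ≠ j := fun e => hjj (Fin.ext e)
          have hdis : List.Disjoint (L.group j') (L.group j) := by
            unfold Leaf.group
            rw [List.getD_eq_getElem _ _ j.2, List.getD_eq_getElem _ _ j'.2]
            rcases Nat.lt_or_gt_of_ne hne' with hlt' | hlt'
            · exact List.Pairwise.rel_get_of_lt (R := List.Disjoint) hgroups_pw (a := ⟨j', j'.2⟩) (b := ⟨j, j.2⟩) hlt'
            · exact (List.Pairwise.rel_get_of_lt (R := List.Disjoint) hgroups_pw (a := ⟨j, j.2⟩) (b := ⟨j', j'.2⟩) hlt').symm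
          exact hdis (hpick j') hc
      · exact absurd (hN _ hcT) (hdisjN _ (mem_flatten_of_mem_group L j.2 hc))
    · rintro rfl; exact ⟨hpick j, Finset.mem_union_left _ (Finset.mem_image_of_mem _ (Finset.mem_univ _))⟩
  -- elements of admissible rows are < n
  have hgroup_lt : ∀ j, ∀ c ∈ L.group j, c < L.n := by
    intro j c hc
    by_cases hj : j < L.k
    · exact hlt _ (List.mem_append_left _ (mem_flatten_of_mem_group L hj hc))
    · unfold Leaf.group at hc; rw [List.getD_eq_default _ _ (not_lt.1 hj)] at hc; simp at hc
  have hadm_lt : ∀ r ∈ L.admissible, ∀ c ∈ r, c < L.n := by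
    intro r hr c hc
    unfold Leaf.admissible at hr
    rcases List.mem_append.1 hr with hr | hr
    · obtain ⟨d, -, rfl⟩ := List.mem_map.1 hr
      unfold Leaf.detRow at hc
      exact List.mem_range.1 (List.mem_filter.1 hc).1
    · obtain ⟨j, -, rfl⟩ := List.mem_map.1 hr
      rcases List.mem_append.1 hc with hc | hc
      · exact hgroup_lt 0 c hc
      · exact hgroup_lt j c hc
  have hrows_lt : ∀ r ∈ L.rows, ∀ i ∈ r, i < L.n := by
    intro r hr i hi
    obtain ⟨adm, hadm, hperm⟩ := hrows r hr
    exact hadm_lt adm hadm i (hperm.subset hi)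
  have hus_lt : ∀ u ∈ L.us, ∀ i ∈ u, i < L.n := by
    rw [hus]; intro u hu i hi
    rw [List.mem_singleton] at hu; subst hu
    exact hgroup_lt 0 i hi
  -- the realisation solves the question
  apply Census.CNFEncode.cnfEncodeAny_unsat_imp hrows_lt hus_lt h
  refine ⟨a, ?_, ?_, ?_⟩
  · -- rows have even parity
    intro r hr
    obtain ⟨adm, hadm, hperm⟩ := hrows r hr
    rw [Bool.eq_false_iff, Ne, lparity_iff_odd, hperm.countP_eq, Nat.not_odd_iff_even]
    unfold Leaf.admissible at hadm
    rcases List.mem_append.1 hadm with hadm | hadm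
    · -- a detector row
      obtain ⟨d, -, rfl⟩ := List.mem_map.1 hadm
      have hnd' : (L.detRow d).Nodup := (List.nodup_range).filter _
      show Even ((L.detRow d).countP fun c => decide (c ∈ T))
      rw [countP_mem_eq_card _ hnd']
      have hset : (L.detRow d).toFinset ∩ T = T.filter fun c => d ∈ L.coordsOf c := by
        ext c
        simp only [Leaf.detRow, Finset.mem_inter, List.mem_toFinset, List.mem_filter, List.mem_range,
          Finset.mem_filter, decide_eq_true_eq]
        constructor
        · rintro ⟨⟨-, h2⟩, h3⟩; exact ⟨h3, h2⟩
        · rintro ⟨h1, h2⟩; exact ⟨⟨hT_lt c h1, h2⟩, h1⟩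
      rw [hset, hT, Finset.filter_union, Finset.card_union_of_disjoint (Finset.disjoint_filter_filter hdisj),
        Finset.filter_image, Finset.card_image_of_injective _ hpick_inj]
      exact heven d
    · -- a link row
      obtain ⟨j, hj, rfl⟩ := List.mem_map.1 hadm
      have hj' : j < L.k := List.mem_range.1 (List.mem_filter.1 hj).1
      rw [List.countP_append, hcount_group ⟨0, hk⟩, hcount_group ⟨j, hj'⟩]
      exact ⟨1, rfl⟩
  · -- the first group is odd
    refine ⟨L.group 0, by rw [hus]; exact List.mem_singleton_self _, ?_⟩
    rw [lparity_iff_odd, hcount_group ⟨0, hk⟩]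
    exact odd_one
  · -- weight
    show (List.range L.n).countP (fun c => decide (c ∈ T)) ≤ L.w
    rw [countP_mem_eq_card _ List.nodup_range]
    calc ((List.range L.n).toFinset ∩ T).card ≤ T.card := Finset.card_le_card Finset.inter_subset_right
      _ ≤ (Finset.univ.image pick).card + N.card := Finset.card_union_le _ _
      _ ≤ L.k + L.budget := by
          apply Nat.add_le_add _ hNcard
          exact (Finset.card_image_le).trans (by simp)
      _ = L.w := by unfold Leaf.budget; omega

end Summit.Ventures.QEC.CircuitDistance.Fibre
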